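import Literature.MathematicalPhysics.QuantumFieldTheory.Balaban1983to89.B8Thm2TorusSupplier
import Literature.MathematicalPhysics.QuantumFieldTheory.Balaban1983to89.B8Thm4TruncationLocal

/-!
# `Balaban1983to89.B8Carve03Prop5Hyp` — [Balaban1985RegularSpaces] pp. 89–95 (Sect. D «Equations for the Gauge Transformation u′»,
# PROPOSITION 5 and its proof, the end of the proof of Theorem 4, (1.74)⁺–(1.114)): P6 CARVING-FAN BLOCK 03 — the block's one residual
# printed sentence (p. 89, the base case `k = 1` with its constant clause `5dLB₀ ≥ 8d²`) in hypothesis form, and ONE hypothesis bundle `Hyp`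
# of the section's theorem (Proposition 5) BY NAME in the currency of its consumer (route P ∕ R3 `stmt-QuantumFields-19200`)

statement-level skeleton of published theorems with citation tags; proofs where landed; nothing here is a claim about the
Yang–Mills mass gap

T. Bałaban, *Spaces of regular gauge field configurations on a lattice and gauge fixing conditions*, Commun. Math. Phys. **99** (1985)
75–102 `[Balaban1985RegularSpaces]` ("B8"; printed page = PDF page + 74).  STATUS: published, refereed.  PDF held:
`paper:balaban1985-cmp99-regular-spaces-gauge-fixing`; pp. 89–95 [PDF 15–21] read by this seat AS IMAGES (renders
`pub-balaban/b2b-balaban-ref1/pages/…-p015-x2.png` … `-p021-x2.png`, 2026-08-28) and on the text layer.  [3] = T. Bałaban, *Averaging operations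
for lattice gauge theories*, CMP **98** (1985) 17–51 `[Balaban1985Averaging]`; [4] = T. Bałaban, *Propagators for lattice gauge theories in a
background field*, CMP **99** (1985) 389–434 `[Balaban1985BackgroundPropagators]`.

CITATION HEADER (lean-in-tree rule).  Cell `lit-balaban` (HOME `run/shared/lean/pub/lit-balaban/`), P6 CARVING FAN (D-0154 (3b)), seat
`lit-balaban-carve-03` = BLOCK 03 of `carve/BLOCKS-01-10.md` (lead g29, 2026-08-28T03:22Z): «B8 pp. 89–95, [B8] Prop 5 and its proof: the
contraction step; 15 SKELETON rows; KEY item stmt-QuantumFields-19200 (route P F2 `B8Prop5StepUniq` consumer), also-feeds 20542».  Filed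
`--supports stmt-QuantumFields-19200 --as helper`.  RULES (`carve/CARVE-RULES.md` §2): IN TREE = CITE, NEVER RESTATE; residual printed statements
in hypothesis form `def …Printed : Prop`; ONE bundle `Hyp`; desk stems `B8Prop5*` ∕ `B8Thm2Torus*` (sub-row G-B8-T2S) are cited, not carved into.

## WHAT THE BLOCK'S PAGES PRINT AND WHERE THE TREE HOLDS IT (cite table; every row of the block is IN TREE — nothing below is restated here)
* row B8.Eq1.77 — (1.75)–(1.77) pp. 89–90: `B8Eq178Averages.ineq175`∕`ineq175_lt` ((1.75)), `ineq176_of_mul` ((1.76)), `Cond177` ((1.77) typed),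
  `reg176_of_cond177`∕`reg177_of_cond177` (p. 90 «These conditions imply the regularity conditions (176), (177) … with 4α₄ instead of α₄»).
* p. 89 «The estimates (1.73), (1.74) together with the condition R₀ū₁ʲ = 1 on Λ_j imply that u₁ satisfies (166), (167) [3] on Bʲ(Λ_j) … with
  α₃ = 16dB₁(α₀ + α₁)»: `B8Prop5LandauDataZd.Cond7374` ((1.73)–(1.74) typed tower-locally), `B8Prop5WitnessOfDatum.inLambdaOn_towers_of_datum`,
  `hwit_of_datum`; «the representation (213) and the bounds (214) [3]» at a general background: `B8Eq178Averages.eq214_qprimeIter_of207`.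
* row B8.Eq1.79 — (1.78)–(1.79) p. 90: `B8Eq178Averages.Cond178`, `Cond179`, `util178`, `Qnl`, `restr129_mul_iff_cond178`, `cond178_iff_cond179_of52`;
  p. 90 «(R₀ū₁^{k−1})(x) = 1 for x ∈ B(Λ_k) implies (R₀ū₁^k)(y) = 1»: `rbar_succ_eq_one_of_block`, `restr129_of_cond168`.
* row B8.Eq1.84 — (1.80)–(1.85) p. 90: `B8Eq184Proof.eq181`, `eq182`, `eq184`, `eq184_printed`; `B8Eq182Proof.gAd` (`g(i ad_Y)X`), `frakF1`, `frakF2`,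
  `norm_frakF1_le` ((1.83), O(1) = 41), `norm_frakF2_le` ((1.85), O(1) = 17).
* row B8.Eq1.87 — (1.86)–(1.89) p. 91: `B8Eq186AdCommutator.adPow`, `Pn`, `eq187`; `B8Eq188Proof.eq188` ((1.88) exact), `frakF3`, `norm_frakF3_le`.
* row B8.Eq1.90 — (1.90) p. 91: `B8Eq190System.Sys190`, `divLog`, `sys190_iff` («Equations (1.79), (1.80) can be written as (1.90)»).
* p. 91 «then D*Dλ = Δλ would belong to the subspace R = ΔN(Q′) and we would have RΔλ = Δλ = (Δ + Q′*aQ′)λ»: `B8Eq191Hprime.R325_lap_eq_lapA`.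
* row B8.Eq1.91 — (1.91)–(1.92) pp. 91–92: `B8Eq191Hprime.Hp` (H′ with body), `q_Hp` (Q′H′ = I), `kernelOf`∕`apply_eq_sum_kernelOf` (the p. 92
  kernel display); (1.92): `B8Ineq192.Ineq192`, `Ineq192Omega`, `ineq192_family`; in the consumer's currency the field laws `hp_…` of
  `B8Thm2TorusLetters.LettersAt` ([4] Thms 3.1–3.3 at one background, hypothesis bundle of sub-row G-B9-LETTERS).
* row B8.Claim@92 — p. 92 «|Rf| ≦ B′₀|f|, hence the operator R[…]R has a L^∞ norm bounded by O(α₄)B′₀²»: `B8Ineq192.rf_bound`, `rowsum_of_349`,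
  `B8Ineq198R.rf_sup_bound`; «|V| ≦ O(α₄)» for V = g(i ad) − 1: `B8Prop5LocalLipschitz.norm_gAd_sub_self_le_mul`.
* row B8.Eq1.95 — (1.93)–(1.96) p. 92: `B8Eq194FirstTerm.firstTerm_eq`, `printed194` ((1.93) → (1.94) «because RΔλ = Δλ»);
  `B8.landau_projection_identities`; `B8SectDSource.isUnit_one_add`, `inverse_one_add_eq_tsum` ((1.96)), `norm_inverse_one_add_le`.
* row B8.Eq1.99 — (1.97)–(1.99) pp. 92–93: `B8Ineq197.ineq197_pointwise`, `ineq197_norm` ((1.97)), `ineq198_local` ((1.98), V-half),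
  `B8Ineq198R.ineq198_R` ((1.98), R-half); (1.99) is the binder `hΦ` of `B8SectDSource.ineq1101` (hypothesis shape of record).
* row B8.Eq1.100 — (1.100) p. 93 and «Q′G′R = Q′G′(I − G′Q′*(Q′G′²Q′*)⁻¹Q′G′) = 0»: `B8.landau_projection_identities`; 𝔉 = G′(g₀ + Φλ) in
  `B8SectDSource.propFive_fixedPoint`.
* row B8.Eq1.101 — (1.101)–(1.103) p. 93: `B8SectDSource.ineq1101`, `fixedPoint_mem_of_invariant`, `norm_fixedPoint_le`.
* row B8.Eq1.106 — (1.104)–(1.106) pp. 93–94: `B8SectDSource.norm_fderiv_le_of_norm_le` (the Cauchy formula (1.105)), `lipschitz_of_norm_le`,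
  `ineq1106`, `contraction_le_half`; `B8.contraction_constant` («4C′₄B′₀B₁(α₀ + α₁) ≦ 2C′₄βα₄ = ½C′₄α₄ ≦ ½ for β = ¼»).
* row B8.Prop5 — PROPOSITION 5 (1.107)–(1.109) p. 94: abstract carrier `B8.Prop5Exists`, `B8.Prop5Unique` (repaired ∕ printed-range forms
  `B8.Prop5UniqueR`, `B8.Prop5UniquePrintedPr`); Banach level `B8SectDSource.propFive_fixedPoint`, `propFive_choice` («α₄ = 8B′₀B₁(α₀ + α₁)»),
  `B8Prop5Repaired.propFive_assembled`, `B8Claim97OntoProof.propFive_constructed` («u′ = exp[i(λ − H′D′(u₁, λ))]»); ON THE TORUS, IN THE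
  CONSUMER'S CURRENCY: `B8Thm2TorusSupplier.SockP5Base` (first step, base datum u₁ = 1), `SockP5Step` (step m ↦ m + 1), `SockP5Uniq` ((1.109)),
  discharged natively by `B8Prop5StepUniq.prop5_unique_step`∕`prop5_unique_base` (route P F2); on `ℤᵈ` members `B8LeafModelZdSockP5uE.SockP5uE`.
  p. 94 «The uniqueness follows from the fact that the image … contains the set {λ′ : |λ′|, |Dλ′|₍₋₁₎ < ¼α₄}» = row B8.Claim@97 (block 04):
  `B8Claim97OntoProof.linMap_onto_quarter`.
* row B8.Eq1.111 — (1.110)–(1.112) p. 95: `B8Eq1110Concrete.ineq1110_pointwise`, `ineq1111_of_1110`; `B8.Thm4Skeleton` (`E110`),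
  `B8.thm4Unique_of_prop5R`, `B8.thm4Printed_of_exists_prop5R`; (1.112) «This follows from Proposition 8 of [3]»: `B8Eq1112Quotient.eq1112_quotient`,
  the level-k re-run `B8Ineq170.rerunRange_7374`; «a configuration identically equal to 1 is a solution also»: `B8Prop5LandauDataZd.lamZero`.
* row B8.Eq1.113 — (1.113)–(1.114) p. 95 ((1.115)–(1.118) p. 96 = block 04): `B8SectEStatements.linMap`, `eq1114`, `Eq1117`, `Dprime`;
  p. 92 «D′(u₁, λ) is analytic in λ … bounded by C′₂(α₃ + α₄)α₄, and also by α₄∕(2B′₀)»: `B8SectEStatements.eq1117_existsUnique`,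
  `B8SectE.b8_sectE_smallness` ((1.121), block 04).

## WHAT THIS FILE ADDS
§1 THE ONE RESIDUAL SENTENCE of pp. 89–95 with no declaration of record — p. 89 ll. 5–9, the BASE CASE `k = 1` WITH ITS CONSTANT CLAUSE:
«We will use only the properties (1.69), (1.73), (1.74) of the configurations u₁, U₁ in the future. They are satisfied in the case k = 1 also,
if we take u₁ = 1, U′ = U₁, because then by Lemma 1 we have |U₁ − 1| < 4d²α₀ + α₁ and U₁ = e^{iA′} = e^{iL⁻¹A} with A satisfying the bounds
(1.69), at least for B₁ not too small, e.g. for B₀ satisfying 5dLB₀ ≧ 8d².»  In tree already: the u₁ = 1 half («(1.68), (1.73), (1.74) hold for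
u₁ = 1»: `B8Prop5LandauDataZd.hyp169_one`, `cond7374_one`, `B8Eq178Averages`∕`B8Thm4TruncationLocal.base_datum` for the bondwise logarithm) and the
abstract leaf `B8.Thm4Skeleton.base`; NOT in tree: the inner implication «|U₁ − 1| < 4d²α₀ + α₁ ⟹ (1.69) at k = 1 with B₁ = 5dLB₀» under the
printed constant clause «5dLB₀ ≧ 8d²».  Typed here as `BaseCaseK1Printed` (hypothesis form, on the `ℤᵈ` carriers of the lineage, (1.69) =
`B8Eq178Averages.Cond169` at one level), with two kernel-checked companions: `baseCaseK1_constant` (the arithmetic the clause buys: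
2(4d²α₀ + α₁) ≦ 5dLB₀(α₀ + α₁)) and `baseCaseK1_first_member` (the FIRST member of (1.69) at k = 1 with print's constant, PROVED from
`|(1∕i) log U| ≦ 2|U − 1|` = `MatrixLog.norm_mlog_le_two_mul` via `B8Thm4TruncationLocal.base_datum`).  HONEST: the gradient member of (1.69) with
the SAME constant is what the sub-cell census located as holding with the margin «5dLB₀ ≧ 8d²(1 + O(α)), rounding only» (docstring of
`B8.Thm4Skeleton`, leaf `base`); it is NOT proved here and `BaseCaseK1Printed` carries it exactly as printed.
§2 THE BUNDLE `Hyp` — Proposition 5 ((1.107)–(1.109), the one theorem printed on pp. 89–95) as HYPOTHESES in the currency of the KEY consumer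
(R3 `stmt-QuantumFields-19200`, route P on the torus `Ω_j = T_η`): the conjunction BY NAME of the desk's sockets `SockP5Base` ∧ (∀ 1 ≦ m < k,
`SockP5Step … m`) ∧ `SockP5Uniq` of `B8Thm2TorusSupplier` — i.e. exactly the Proposition-5 conjuncts of the desk's `Thm2TorusSockets` (whose other
conjuncts, the (1.42) clause `Sock142` and the in-edge (1.59) `Sock159`, are printed on pp. 83–87 = blocks 02∕01); with the two ∧-bookkeeping
lemmas `hyp_of_thm2TorusSockets` and `thm2TorusSockets_of_hyp` so that a node prover holding `(h : Hyp …)` plugs into the desk's drivers.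

## v1.1 (APPEND-ONLY; seat `carve-03` gen 2, 2026-08-28) — THE RE-FILE ASKED BY `carve/CHECK-3.md` M-c3-1 (check-3, 05:54Z)
Check-3's statement-vs-print audit of v1 (p607516): everything PASS except **M-c3-1 — `BaseCaseK1Printed` MISSTATED**: typed as the
CONTEXT-FREE implication «5dLB₀ ≧ 8d² → (|U₁ − 1| < 4d²α₀ + α₁ at every bond) → ∃ A, U₁ = e^{iηA} ∧ (1.69) at k = 1», it drops the
setting in which p. 89 speaks (the proof of Theorem 4 at `k = 1`: «Let us take configurations U₀, U′U₀ satisfying the conditions (1.33), (1.34),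
(1.66)», p. 88) and is then FALSE at print's own clause `5dLB₀ = 8d²` (check-3's witness: `𝔸 = ℂ`, `d = L = 2`, `B₀ = 8∕5`, `η = 1`, `α₀ = 1∕100`,
`α₁ = 0`, `U₁(x, e₁) = e^{iθ(−1)^{x₀}}`, `θ = 0.16`: the alternating sign saturates `|∇A| = 2θ`, a configuration violating the standing (1.33)∕(1.66));
severity «boundary-only, zero consumers»; fix F1 (faithful): the sentence's two consequences UNDER Theorem 4's `k = 1` hypotheses, Lemma 1's bound
said «on Ω₁» (N-c3-1).  THIS VERSION (all six v1 declarations byte-identical; `BaseCaseK1Printed` kept, its docstring now points here):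
§3 `ThmFourSettingAtOne` — Theorem 4's hypotheses AT `k = 1` for the pair `(U₀, U′ = U₁)` and a domain sequence `Ω₀ ⊃ Ω₁`, in the tree's
currency BY NAME: (1.33) = `B8Eq133Hypotheses.Hyp133` (`U₀ ∈ 𝔄₁({Ω_j}, α₀)` and (3.35) of [4]), (1.34) = `B8Eq133Hypotheses.Hyp134`
(`U₁U₀ ∈ 𝔄₁({Ω_j}, α₀) ∩ Ax₁(𝔅₁, U₀)`), (1.66) at `j = 0, 1` with the averages `Ũ′ʲ = B8Prop6OfThm4.tavg` of (1.20) (in tree (1.66) is typed for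
`Ω_j = T_η`, `B8Thm4TorusAt.Cond166T`, and for the admissible cubes, `B8Prop6OfThm4.Cond166`; here for a general sequence at `k = 1`:
`Ω₀⁽⁰⁾ = Ω₀`, `Ω₁⁽¹⁾ = Λ₁` by (1.5)), the fields `G`-valued, `G ⊂ U(N)` (`B7Prop2Explicit.unitaryUnits`), and the nesting (1.3) `Ω₁ ⊂ Ω₀`;
`BaseCaseK1InContextPrinted` — p. 89 ll. 5–9 IN THAT SETTING (F1): under «α₀ + α₁ ≦ c₁» (Theorem 4) and the clause «5dLB₀ ≧ 8d²», (a) Lemma 1's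
«|U₁ − 1| < 4d²α₀ + α₁» on the bonds of `Ω₁` and (b) «U₁ = e^{iηA} with A satisfying the bounds (1.69)» — `r05`'s `Cond169` at `k = 1` (both
members, on `Ω₀`, constant `B₁(α₀ + α₁) = 5dLB₀(α₀ + α₁)`), the representation read on the bonds of `Ω₀` = the domain of (1.69) at `k = 1`;
**`baseCaseK1InContext_holds` — PROVED for every `c₁ ≦ ¼`** (so the block's one residual sentence is now a certified statement, not only a typed
one): in the setting, (1.66) at level `0` is «|U′ − 1| < α₁ on Ω₀» (`tavg_zero`: `Ũ′⁰ = U′`), whence (a) on `Ω₁ ⊂ Ω₀` a fortiori, and (b) with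
`A = (1∕iη) log U₁` on the bonds of `Ω₀` (`B8Thm4TruncationLocal.base_datum`: `|(1∕i) log U| ≦ 2|U − 1|`) and the contraction `|R(U₀(b))X| ≦ |X|`
for unitary `U₀` (`B8Ineq132.norm_conjR`): `|A| < 2α₁η⁻¹`, `|∇^η_{U₀}A| < 4α₁η⁻²`, and `4α₁ ≦ 8d²(α₀ + α₁) ≦ 5dLB₀(α₀ + α₁)` — print's «e.g.»
clause holds with room IN CONTEXT (the sliver of M-c3-1 lives outside (1.33)∕(1.66)); `thmFourSettingAtOne_one` — the setting is inhabited
(`U₀ = U′ = 1`, `B8Eq133Hypotheses.hyp133to135_one`).  N-c3-2 (`export … (Site)`) left as is per check-3 («fine as is»).  The bundle `Hyp` and its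
two lemmas are untouched (check-3: PASS); `BaseCaseK1InContextPrinted` is, like `BaseCaseK1Printed`, NOT a conjunct of `Hyp`.

## HONEST SCOPE
Nothing of [B8] is proved here beyond the p. 89 arithmetic, the first (1.69)-member at k = 1, and (v1.1) the p. 89 base-case sentence in Theorem 4's
k = 1 setting for `α₀ + α₁ ≦ c₁ ≦ ¼`; Proposition 5 is NOT re-proved (its
hypothesis-form sockets are the desk's, discharged by route P's servers `B8Thm2TorusServerP*`, `B8Prop5StepUniq`); no summit statement is proved by
this seat; count-neutral; nothing continuum ∕ ℝ⁴ ∕ OS ∕ mass-gap ∕ Clay.  No `sorry`, no `instance`, no `notation`; four hypothesis-form `def … : Prop`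
(`BaseCaseK1Printed` (superseded, kept), `Hyp`, `ThmFourSettingAtOne`, `BaseCaseK1InContextPrinted` (proved for `c₁ ≦ ¼`)), seven theorems.
-/

noncomputable section

open NormedSpace

namespace Literature.MathematicalPhysics.QuantumFieldTheory.Balaban1983to89.B8Carve03Prop5Hyp

open Complex (I)
open MatrixLog B7Prop1Explicit B7Prop2Explicit
open B8Ineq132 (covDerivFwd BondTouches)
open B8Eq184Proof (gaugeExp cfgExp)
open B8Eq178Averages (Cond169)
open B8Thm2TorusSupplier (SockP5Base SockP5Step SockP5Uniq Sock142 Sock159 Thm2TorusSockets alpha4T cstarT alpha1e guardT)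

-- `Site` alone could resolve to the torus sites of `Setup.lean`; re-export the `ℤ^d` sites of `B7Prop1Explicit`.
export B7Prop1Explicit (Site)

variable {d : ℕ}

/-! ## §1  The residual sentence of p. 89: the base case `k = 1` and its constant clause `5dLB₀ ≧ 8d²` -/

/-- **What the clause «5dLB₀ ≧ 8d²» buys** (kernel arithmetic, the cell's "second engine" for p. 89): with `|(1∕i) log U| ≦ 2|U − 1|` the first
member of (1.69) at `k = 1` needs `2(4d²α₀ + α₁) ≦ B₁(α₀ + α₁)`, and for `d ≧ 1`, `α₀, α₁ ≧ 0` this follows from `8d² ≦ 5dLB₀ = B₁`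
(`2α₁ ≦ 8d²α₁`).  Pure real arithmetic (`d, L, B₀` real here). [cite: Balaban1985RegularSpaces, p.89 (sentence after (1.74)), Prop. 3 p.87] -/
theorem baseCaseK1_constant {d L B₀ α₀ α₁ : ℝ} (hd : 1 ≤ d) (hB : 8 * d ^ 2 ≤ 5 * d * L * B₀) (hα₀ : 0 ≤ α₀) (hα₁ : 0 ≤ α₁) :
    2 * (4 * d ^ 2 * α₀ + α₁) ≤ 5 * d * L * B₀ * (α₀ + α₁) := by
  have hd2 : 1 ≤ d ^ 2 := by nlinarith
  have h1 : 2 * (4 * d ^ 2 * α₀ + α₁) ≤ 8 * d ^ 2 * (α₀ + α₁) := by nlinarith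
  have h2 : 8 * d ^ 2 * (α₀ + α₁) ≤ 5 * d * L * B₀ * (α₀ + α₁) :=
    mul_le_mul_of_nonneg_right hB (add_nonneg hα₀ hα₁)
  exact h1.trans h2

section BaseCase

variable {𝔸 : Type*} [NormedRing 𝔸] [NormedAlgebra ℂ 𝔸] [CompleteSpace 𝔸]

/-- **p. 89, ll. 5–9 [PDF 15]** (the sentence after (1.74)), verbatim: «We will use only the properties (1.69), (1.73), (1.74) of the
configurations u₁, U₁ in the future. They are satisfied in the case k = 1 also, if we take u₁ = 1, U′ = U₁, because then by Lemma 1 we have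
|U₁ − 1| < 4d²α₀ + α₁ and U₁ = e^{iA′} = e^{iL⁻¹A} with A satisfying the bounds (1.69), at least for B₁ not too small, e.g. for B₀ satisfying
5dLB₀ ≧ 8d².»  TYPED: the sentence's inner implication for the field, in hypothesis form on the `ℤᵈ` carriers of the lineage — under the
printed constant clause `8d² ≦ 5dLB₀` (B₁ = 5dLB₀ is Proposition 3's constant, p. 87), Lemma 1's output «|U₁ − 1| < 4d²α₀ + α₁» (printed
unqualified; at every bond) implies that `U₁ = e^{iηA}` for some `A` (print: `A′ = ηA`, `η = L⁻¹` at `k = 1`; the lineage keeps `η` free) with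
(1.69) AT ONE LEVEL (`k = 1`: «on Ω_j, j = 0, …, k − 1» = `Ω₀` only) and slot constant `B₁(α₀ + α₁) = 5dLB₀(α₀ + α₁)` — (1.69) being r05's typed
`B8Eq178Averages.Cond169` (both members: `|A| < c(Lʲη)⁻¹` and `|∇^η_{U₀}A| < c(Lʲη)⁻²` on the bonds of `Ω_j`).  The u₁ = 1 half of the
sentence ((1.68), (1.73), (1.74) for `u₁ = 1`) is in tree: `B8Prop5LandauDataZd.hyp169_one`, `cond7374_one`.  HONEST: the first member holds
with this constant (`baseCaseK1_first_member`); for the gradient member the sub-cell census located the margin as «5dLB₀ ≧ 8d²(1 + O(α)),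
rounding only» (docstring of `B8.Thm4Skeleton`, leaf `base`) — carried here exactly as printed, asserted for nothing.
**SUPERSEDED (v1.1; `carve/CHECK-3.md` M-c3-1, 2026-08-28): as a CONTEXT-FREE implication this Prop is FALSE at print's own clause
`5dLB₀ = 8d²`** (check-3's witness: `𝔸 = ℂ`, `d = L = 2`, `B₀ = 8∕5`, `η = 1`, `α₀ = 1∕100`, `α₁ = 0`, `Ω ≡ univ`, `U₀ ≡ 1`, `U₁(x, e₀) = 1`,
`U₁(x, e₁) = e^{iθ(−1)^{x₀}}`, `θ = 0.16`: the first member of (1.69) forces `A(x, e₁) = ±θ`, and then `|∇A| = 2θ = 0.32 ≮ 0.32` — a configuration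
with plaquette angle `2θ ≫ α₀η²`, i.e. OUTSIDE the standing (1.33)∕(1.66) that p. 89 presupposes).  The faithful reading — the same sentence IN
THEOREM 4's SETTING AT `k = 1` — is `BaseCaseK1InContextPrinted` (§3 below), PROVED there for `α₀ + α₁ ≦ c₁ ≦ ¼` (`baseCaseK1InContext_holds`).
This declaration is kept byte-identical (append-only discipline); it has no consumer; do not use it.
[cite: Balaban1985RegularSpaces, p.89 (sentence after (1.74)), (1.69) p.88, Lemma 1 (1.25) p.79, Prop. 3 p.87] -/
def BaseCaseK1Printed (L : ℕ) (η B₀ α₀ α₁ : ℝ) (Ω : ℕ → Set (Site d)) (U₀ U₁ : Site d → Fin d → 𝔸ˣ) : Prop :=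
  8 * (d : ℝ) ^ 2 ≤ 5 * (d : ℝ) * L * B₀ →
    (∀ (x : Site d) (τ : Fin d), ‖((U₁ x τ : 𝔸ˣ) : 𝔸) - 1‖ < 4 * (d : ℝ) ^ 2 * α₀ + α₁) →
      ∃ A : Site d → Fin d → 𝔸, U₁ = cfgExp η A ∧ Cond169 L 1 η Ω U₀ A (5 * (d : ℝ) * L * B₀ * (α₀ + α₁))

end BaseCase

section BaseCaseFirst

variable {𝔸 : Type*} [CStarAlgebra 𝔸]

/-- **THE FIRST MEMBER OF (1.69) AT `k = 1` WITH PRINT'S CONSTANT, PROVED** (p. 89 «by Lemma 1 we have |U₁ − 1| < 4d²α₀ + α₁ and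
U₁ = e^{iA′} = e^{iL⁻¹A} with A satisfying the bounds (1.69), at least … for B₀ satisfying 5dLB₀ ≧ 8d²»): for a unitary-valued `U₁` with
`|U₁(b) − 1| < 4d²α₀ + α₁ ≦ ¼` at every bond, the bondwise logarithm `A(b) := η⁻¹(1∕i) log U₁(b)` (`MatrixLog.mlog`, the series (21) of [3]) has
`U₁ = e^{iηA}` (`B8Eq184Proof.cfgExp`), is Hermitian, and satisfies `|A(b)| < 5dLB₀(α₀ + α₁)·(L⁰η)⁻¹` = the first member of (1.69) at the one
level `j = 0` of `k = 1`, GIVEN `8d² ≦ 5dLB₀`, `d ≧ 1` — by `B8Thm4TruncationLocal.base_datum` (`|(1∕i) log U| ≦ 2|U − 1|`) and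
`baseCaseK1_constant`.  The gradient member is not claimed (see `BaseCaseK1Printed`).
[cite: Balaban1985RegularSpaces, p.89 (sentence after (1.74)), (1.69) p.88; Balaban1985Averaging, (21)–(24) p.21] -/
theorem baseCaseK1_first_member {η : ℝ} (hη : 0 < η) {L : ℕ} {B₀ α₀ α₁ : ℝ} (hd : 1 ≤ d)
    (hB : 8 * (d : ℝ) ^ 2 ≤ 5 * (d : ℝ) * L * B₀) (hα₀ : 0 ≤ α₀) (hα₁ : 0 ≤ α₁)
    (hsm : 4 * (d : ℝ) ^ 2 * α₀ + α₁ ≤ 1 / 4) (U₀ U₁ : Site d → Fin d → 𝔸ˣ) (hU₁ : ∀ x κ, U₁ x κ ∈ unitaryUnits 𝔸)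
    (h : ∀ (x : Site d) (τ : Fin d), ‖((U₁ x τ : 𝔸ˣ) : 𝔸) - 1‖ < 4 * (d : ℝ) ^ 2 * α₀ + α₁) :
    ∃ A : Site d → Fin d → 𝔸, U₁ = cfgExp η A ∧ (∀ (x : Site d) (τ : Fin d), IsSelfAdjoint (A x τ)) ∧
      ∀ (x : Site d) (τ : Fin d), ‖A x τ‖ < 5 * (d : ℝ) * L * B₀ * (α₀ + α₁) * ((L : ℝ) ^ 0 * η)⁻¹ := by
  set A : Site d → Fin d → 𝔸 := fun y μ => η⁻¹ • ((I⁻¹ : ℂ) • mlog ((U₁ y μ : 𝔸ˣ) : 𝔸)) with hA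
  have hbd : ∀ (x : Site d) (κ : Fin d),
      U₁ x κ = cfgExp η A x κ ∧ IsSelfAdjoint (A x κ) ∧ ‖A x κ‖ ≤ 2 * ‖((U₁ x κ : 𝔸ˣ) : 𝔸) - 1‖ * η⁻¹ := by
    intro x κ
    have ha : ‖((U₁ x κ : 𝔸ˣ) : 𝔸) - 1‖ ≤ 1 / 4 := (h x κ).le.trans hsm
    obtain ⟨-, h2, h3, h4⟩ := B8Thm4TruncationLocal.base_datum hη U₀ U₁ hU₁ ha x κ le_rfl
    exact ⟨h2, h3, h4⟩
  refine ⟨A, ?_, fun x τ => (hbd x τ).2.1, fun x τ => ?_⟩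
  · funext x κ
    exact (hbd x κ).1
  · have hη' : 0 < η⁻¹ := inv_pos.mpr hη
    have hd' : (1 : ℝ) ≤ d := by exact_mod_cast hd
    have hc := baseCaseK1_constant hd' hB hα₀ hα₁
    calc ‖A x τ‖ ≤ 2 * ‖((U₁ x τ : 𝔸ˣ) : 𝔸) - 1‖ * η⁻¹ := (hbd x τ).2.2
      _ < 2 * (4 * (d : ℝ) ^ 2 * α₀ + α₁) * η⁻¹ := by
          have := h x τ
          nlinarith
      _ ≤ 5 * (d : ℝ) * L * B₀ * (α₀ + α₁) * η⁻¹ := mul_le_mul_of_nonneg_right hc hη'.le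
      _ = 5 * (d : ℝ) * L * B₀ * (α₀ + α₁) * ((L : ℝ) ^ 0 * η)⁻¹ := by rw [pow_zero, one_mul]

end BaseCaseFirst

/-! ## §2  The bundle: Proposition 5 (pp. 89–95) as hypotheses in the consumer's currency, by name -/

section Bundle

variable {𝔸 : Type*} [NormedRing 𝔸] [StarRing 𝔸] [NormedAlgebra ℂ 𝔸] [CompleteSpace 𝔸]

/-- **BLOCK 03 BUNDLE — PROPOSITION 5 (p. 94, (1.107)–(1.109)) AS HYPOTHESES ON THE TORUS `Ω_j = T_η`, BY NAME.**  Print: «Proposition 5.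
There exist positive constants c₂, c₃, depending on d and L only, such that for an arbitrary configuration U₁ satisfying (1.69), and for the
configuration u₁ determined by U₁ and satisfying (1.68), (1.73), (1.74), if α₀ + α₁ ≦ c₂, then there exists a configuration u′ = e^{iλ}
satisfying the equations RD*(1∕iη) log U₁^{u′⁻¹} = 0, \overline{R₀u′u₁}ʲ = 1 on Λ_j, j = 0, 1, …, k (1.107) and the bounds |λ|, |Dλ|₍₋₁₎ <
8B′₀B₁(α₀ + α₁). (1.108)  Such a configuration u′ is unique in the domain |λ|, |Dλ|₍₋₁₎ < c₃. (1.109)»  The bundle conjoins, for one `P`-periodic pair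
`(U₀, U′)`, one gauge group `G` and `k` levels, the desk's three hypothesis-form readings of this proposition on the torus
(`B8Thm2TorusSupplier`, sub-row G-B8-T2S, cited not restated): existence at the first step for the base datum `u₁ = 1, U′ = U₁` of p. 89
(`SockP5Base`, radius `α₄`), existence at every step `m ↦ m + 1`, `1 ≦ m < k`, for the level-`m` datum of Theorem 4's induction (`SockP5Step`,
datum constant `c⋆ = B₁(α₀ + α₁)`, radius `α₄`), and the uniqueness clause (1.109) for level-`k` solution data (`SockP5Uniq`, constant `c_A`,
radius `c_u`) — exactly the Proposition-5 conjuncts of the desk's `Thm2TorusSockets` (`hyp_of_thm2TorusSockets`, `thm2TorusSockets_of_hyp`).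
Keyed to R3 `stmt-QuantumFields-19200` (route P); a node prover takes `(h : Hyp …)`.  Hypothesis shape, asserted for nothing.
[cite: Balaban1985RegularSpaces, Prop. 5 (1.107)–(1.109) p.94, pp.88–89 (the datum (1.68)–(1.69), the base case)] -/
def Hyp (L k : ℕ) (P : ℤ) (η cstar α₄ cA cu : ℝ) (G : Subgroup 𝔸ˣ) (U₀ U' : Site d → Fin d → 𝔸ˣ) : Prop :=
  SockP5Base L P η α₄ G U₀ U' ∧
    (∀ m, 1 ≤ m → m < k → SockP5Step L P η cstar α₄ G U₀ U' m) ∧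
    SockP5Uniq L k P η cA cu G U₀ U'

/-- **The desk's socket bundle contains the block-03 bundle**: `Thm2TorusSockets` (Theorem 2's six sockets at one pair and one `(α₀, α₁)`)
gives `Hyp` at the desk's constants `c⋆ = cstarT d L B₀ α₀ α₁` (= 5dLB₀(α₀ + α₁′)), `α₄ = alpha4T d B₄ α₀ α₁` (= B₄(α₀ + α₁′), B₄ = 8B′₀B₁),
`c_A = B₁(α₀ + α₁)` — projection on the first, second and sixth conjuncts. [cite: Balaban1985RegularSpaces, Prop. 5 (1.107)–(1.109) p.94] -/
theorem hyp_of_thm2TorusSockets {L k : ℕ} {P : ℤ} {η β₀ B₀ B₀β B₄ cu B₁ : ℝ} {len : Site d → ℝ} {G : Subgroup 𝔸ˣ} {α₀ α₁ : ℝ}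
    {U₀ U' : Site d → Fin d → 𝔸ˣ} (hS : Thm2TorusSockets L k P η β₀ B₀ B₀β B₄ cu B₁ len G α₀ α₁ U₀ U') :
    Hyp L k P η (cstarT d L B₀ α₀ α₁) (alpha4T d B₄ α₀ α₁) (B₁ * (α₀ + α₁)) cu G U₀ U' :=
  ⟨hS.1, hS.2.1, hS.2.2.2.2.2⟩

/-- **Conversely**: the block-03 bundle at the desk's constants together with the sockets printed OUTSIDE pp. 89–95 — the (1.42) clause
`Sock142` at the levels `m < k` (constant `11d²α₀ + α₁` of (1.66)) and at the top level `k` (constant `α₁` of (1.35)), and the in-edge (1.59)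
`Sock159` at every level `1 ≦ m ≦ k` — reassembles the desk's `Thm2TorusSockets`, the input of its drivers (`B8Thm2TorusSupplier.torus_all_levels`
ff.). [cite: Balaban1985RegularSpaces, Prop. 5 p.94, (1.42) p.83, (1.59) p.86, Thm 2 p.83] -/
theorem thm2TorusSockets_of_hyp {L k : ℕ} {P : ℤ} {η β₀ B₀ B₀β B₄ cu B₁ : ℝ} {len : Site d → ℝ} {G : Subgroup 𝔸ˣ} {α₀ α₁ : ℝ}
    {U₀ U' : Site d → Fin d → 𝔸ˣ} (h : Hyp L k P η (cstarT d L B₀ α₀ α₁) (alpha4T d B₄ α₀ α₁) (B₁ * (α₀ + α₁)) cu G U₀ U')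
    (h142 : ∀ m, 1 ≤ m → m < k → Sock142 L P η (alpha1e d α₀ α₁) (guardT d L B₀ B₄ α₀ α₁) G U₀ U' m)
    (h142k : Sock142 L P η α₁ (guardT d L B₀ B₄ α₀ α₁) G U₀ U' k)
    (h159 : ∀ m, 1 ≤ m → m ≤ k → Sock159 L P η β₀ B₀ B₀β (guardT d L B₀ B₄ α₀ α₁) len G U₀ U' m) :
    Thm2TorusSockets L k P η β₀ B₀ B₀β B₄ cu B₁ len G α₀ α₁ U₀ U' :=
  ⟨h.1, h.2.1, h142, h142k, h159, h.2.2⟩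

end Bundle

/-! ## §3  (v1.1) The p. 89 base-case sentence IN THEOREM 4's SETTING AT `k = 1` — the re-file asked by `carve/CHECK-3.md` M-c3-1 -/

section InContext

open B7Eq78Linearization (conjR)
open B8Eq133Hypotheses (Hyp133 Hyp134)
open B8Prop6OfThm4 (tavg)

variable {𝔸 : Type*} [CStarAlgebra 𝔸]

/-- **(1.20) at `n = 0`: `Ũ′⁰ = U′`** — the `0`-fold averages are the configurations themselves (`B7Prop2Explicit.avgIter_zero`), so
`Ũ′⁰ = (U′U₀)U₀⁻¹ = U′`; hence (1.66) at `j = 0` reads «|U′ − 1| < α₁ on Ω₀⁽⁰⁾ = Ω₀».  (`B8Prop6OfThm4.tavg` is the tree's letter for the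
averages `Ũ′ⁿ = (\overline{U′U₀})ⁿ(Ū₀ⁿ)⁻¹` of (1.20).) [cite: Balaban1985RegularSpaces, (1.20) p.79, (1.66) p.87] -/
theorem tavg_zero (L : ℕ) (U₀ U' : Site d → Fin d → 𝔸ˣ) : tavg L U₀ U' 0 = U' := by
  funext x κ
  simp [tavg, Pi.mul_apply, mul_inv_cancel_right]

/-- **THEOREM 4's SETTING AT `k = 1`** for the pair `(U₀, U′)`, `U′ = U₁` (p. 89 «if we take u₁ = 1, U′ = U₁»), one domain sequence
`Ω₀ ⊃ Ω₁` of (1.3) (fine-lattice site sets `Ω j`, bonds ∕ plaquettes by the touching convention of p. 77) and constraint sites `Λ j` (level-`j`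
sites; `Λ₁ = Ω₁⁽¹⁾` by (1.5) at `k = 1`).  Print, p. 88 [PDF 14]: «Theorem 4. There exists a constant c₁ such that for arbitrary U₀, U′U₀ satisfying
(1.33), (1.34), (1.66) with α₀ + α₁ ≦ c₁ there exists exactly one gauge transformation u …» and l. 13 «Let us take configurations U₀, U′U₀
satisfying the conditions (1.33), (1.34), (1.66).»; p. 82 [PDF 8]: «U₀ ∈ 𝔄_k({Ω_j}, α₀), U₀ satisfies the regularity condition (3.35) in [4]. (1.33)
U′U₀ ∈ 𝔄_k({Ω_j}, α₀) ∩ Ax_k(𝔅_k, U₀), (1.34)»; p. 87 [PDF 13]: «|(\overline{U′U₀})ʲ − Ū₀ʲ| = |Ũ′ʲ − 1| < α₁ on Ω_j⁽ʲ⁾, j = 0, 1, …, k. (1.66)».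
TYPED AT `k = 1`, IN THE TREE's CURRENCY BY NAME (nothing restated): the fields take values in the (unitary) gauge group `G ⊂ U(N)` of the paper
(`B7Prop2Explicit.unitaryUnits`, [3] p. 23); (1.3) `Ω₁ ⊂ Ω₀`; (1.33) = `B8Eq133Hypotheses.Hyp133 L 1 η α₀ Ω 𝒬 C U₀` (`𝔄₁` = `B8Ineq132.InAk`,
(3.35) of [4] = `Reg335Zd` with its cube class `𝒬` and constant `C`); (1.34) = `B8Eq133Hypotheses.Hyp134 L 1 η α₀ Ω Λ U₀ U₁` (`U₁U₀ ∈ 𝔄₁` and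
`∈ Ax₁(𝔅₁, U₀)` = `B8Eq119TwistedAxial.InAx`); (1.66) at `j = 0` («on Ω₀⁽⁰⁾ = Ω₀», the bonds touching `Ω 0`; `Ũ′⁰ = U′`, `tavg_zero`) and at
`j = 1` («on Ω₁⁽¹⁾ = Λ₁», the level-`1` bonds touching `Λ 1`), both with the averages `Ũ′ʲ = B8Prop6OfThm4.tavg L U₀ U₁ j` of (1.20) — in tree
(1.66) is typed for `Ω_j = T_η` (`B8Thm4TorusAt.Cond166T`) and for the admissible cubes (`B8Prop6OfThm4.Cond166`), here for a general sequence at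
`k = 1`.  Of the geometric conditions (1.3)–(1.6) only the nesting is recorded (the one the p. 89 sentence uses).  A hypothesis SHAPE (the antecedent
of `BaseCaseK1InContextPrinted`); inhabited (`thmFourSettingAtOne_one`).
[cite: Balaban1985RegularSpaces, Thm 4 p.88, (1.33)–(1.34) p.82, (1.66) p.87, (1.3)–(1.5) p.77, (1.20) p.79] -/
def ThmFourSettingAtOne (L : ℕ) (η α₀ α₁ : ℝ) (Ω Λ : ℕ → Set (Site d)) (𝒬 : Set (Set (Site d) × ℕ)) (C : ℝ)
    (U₀ U₁ : Site d → Fin d → 𝔸ˣ) : Prop :=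
  (∀ (x : Site d) (κ : Fin d), U₀ x κ ∈ unitaryUnits 𝔸) ∧ (∀ (x : Site d) (κ : Fin d), U₁ x κ ∈ unitaryUnits 𝔸) ∧
    Ω 1 ⊆ Ω 0 ∧ Hyp133 L 1 η α₀ Ω 𝒬 C U₀ ∧ Hyp134 L 1 η α₀ Ω Λ U₀ U₁ ∧
    (∀ (x : Site d) (τ : Fin d), BondTouches (Ω 0) x τ → ‖((tavg L U₀ U₁ 0 x τ : 𝔸ˣ) : 𝔸) - 1‖ < α₁) ∧
    (∀ (y : Site d) (κ : Fin d), BondTouches (Λ 1) y κ → ‖((tavg L U₀ U₁ 1 y κ : 𝔸ˣ) : 𝔸) - 1‖ < α₁)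

/-- **p. 89, ll. 5–9 [PDF 15], IN CONTEXT (the F1 re-file of `carve/CHECK-3.md` M-c3-1; supersedes `BaseCaseK1Printed`)**, verbatim: «We will use
only the properties (1.69), (1.73), (1.74) of the configurations u₁, U₁ in the future. They are satisfied in the case k = 1 also, if we take u₁ = 1,
U′ = U₁, because then by Lemma 1 we have |U₁ − 1| < 4d²α₀ + α₁ and U₁ = e^{iA′} = e^{iL⁻¹A} with A satisfying the bounds (1.69), at least for B₁
not too small, e.g. for B₀ satisfying 5dLB₀ ≧ 8d².»  TYPED: under print's size clause `8d² ≦ 5dLB₀` (`B₁ = 5dLB₀`, Prop. 3 p. 87), for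
`0 < α₀`, `0 < α₁` with Theorem 4's «α₀ + α₁ ≦ c₁» (`c₁` a parameter, as in the tree's Theorem-4 interface `B8Eq119TwistedAxial.Thm4At`; Lemma 1:
«for α₀, α₁ small»), and for a pair `(U₀, U₁)` IN THEOREM 4's SETTING AT `k = 1` (`ThmFourSettingAtOne`: (1.33), (1.34), (1.66), `G`-valued,
`Ω₁ ⊂ Ω₀`), the sentence's two consequences: (a) Lemma 1's (1.25) «|U₁ − 1| < 4d²α₀ + α₁» ON THE BONDS OF `Ω₁` (Lemma 1 p. 79: «on Ω₁»;
check-3 N-c3-1), and (b) «U₁ = e^{iA′} = e^{iL⁻¹A} with A satisfying the bounds (1.69)»: a bond function `A` with `U₁ = e^{iηA}`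
(`B8Eq184Proof.cfgExp`; print's `η = L⁻¹` at `k = 1`, the lineage keeps `η` free) and (1.69) AT `k = 1` = `r05`'s `B8Eq178Averages.Cond169 L 1 η Ω U₀ A c`
— both members, `|A| < c(L⁰η)⁻¹` and `|∇^η_{U₀}A| < c(L⁰η)⁻²` on the bonds of `Ω₀` («on Ω_j, j = 0, …, k − 1») — with `c = B₁(α₀ + α₁) =
5dLB₀(α₀ + α₁)`.  READING: the representation `U₁ = e^{iηA}` is asserted on the bonds of `Ω₀`, the domain of (1.69) at `k = 1` (outside `Ω₀` (1.69)
says nothing; for print's matrix groups a global logarithm exists trivially, in the tree's C⋆-generality it need not).  PROVED for every `c₁ ≦ ¼`: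
`baseCaseK1InContext_holds`.  Not a conjunct of the bundle `Hyp`.
[cite: Balaban1985RegularSpaces, p.89 (sentence after (1.74)), (1.69) p.88, Thm 4 p.88, Lemma 1 (1.25) p.79, Prop. 3 p.87] -/
def BaseCaseK1InContextPrinted (L : ℕ) (η B₀ c₁ α₀ α₁ : ℝ) (Ω Λ : ℕ → Set (Site d)) (𝒬 : Set (Set (Site d) × ℕ))
    (C : ℝ) (U₀ U₁ : Site d → Fin d → 𝔸ˣ) : Prop :=
  8 * (d : ℝ) ^ 2 ≤ 5 * (d : ℝ) * L * B₀ → 0 < α₀ → 0 < α₁ → α₀ + α₁ ≤ c₁ →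
    ThmFourSettingAtOne L η α₀ α₁ Ω Λ 𝒬 C U₀ U₁ →
      (∀ (x : Site d) (τ : Fin d), BondTouches (Ω 1) x τ → ‖((U₁ x τ : 𝔸ˣ) : 𝔸) - 1‖ < 4 * (d : ℝ) ^ 2 * α₀ + α₁) ∧
        ∃ A : Site d → Fin d → 𝔸, (∀ (x : Site d) (τ : Fin d), BondTouches (Ω 0) x τ → U₁ x τ = cfgExp η A x τ) ∧
          Cond169 L 1 η Ω U₀ A (5 * (d : ℝ) * L * B₀ * (α₀ + α₁))

/-- **THE SETTING IS INHABITED**: the pair `U₀ = U′ = 1` is in Theorem 4's `k = 1` setting for every nested domain sequence, every constraint family,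
every cube class and all `α₀, α₁, C > 0` (`L ≧ 1`, `η > 0`) — (1.33)–(1.34) by `B8Eq133Hypotheses.hyp133to135_one` (p. 98 «identically equal to 1
satisfies, of course, all possible regularity conditions»), (1.66) because all averages of `1` are `1` (`B8Prop6OfThm4.tavg_one`,
`B8Ineq132.avgIter_one`).  (`Nontrivial 𝔸`: print's `M_N(ℂ)`; needed only by the cited lemma's `|1| = 1`.)
[cite: Balaban1985RegularSpaces, Thm 4 p.88, (1.33)–(1.34) p.82, (1.66) p.87, p.98] -/
theorem thmFourSettingAtOne_one [Nontrivial 𝔸] {L : ℕ} (hL : 1 ≤ L) {η α₀ α₁ C : ℝ} (hη : 0 < η) (hα₀ : 0 < α₀) (hα₁ : 0 < α₁)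
    (hC : 0 < C) {Ω : ℕ → Set (Site d)} (hΩ : Ω 1 ⊆ Ω 0) (Λ : ℕ → Set (Site d)) (𝒬 : Set (Set (Site d) × ℕ)) :
    ThmFourSettingAtOne L η α₀ α₁ Ω Λ 𝒬 C (1 : Site d → Fin d → 𝔸ˣ) 1 := by
  have h := B8Eq133Hypotheses.hyp133to135_one (𝔸 := 𝔸) hL 1 hη hα₀ hα₁ hC Ω Λ 𝒬
  refine ⟨fun _ _ => (unitaryUnits 𝔸).one_mem, fun _ _ => (unitaryUnits 𝔸).one_mem, hΩ, h.1, h.2.1, ?_, ?_⟩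
  · intro x τ _
    rw [B8Prop6OfThm4.tavg_one, B8Ineq132.avgIter_one]
    simpa using hα₁
  · intro y κ _
    rw [B8Prop6OfThm4.tavg_one, B8Ineq132.avgIter_one]
    simpa using hα₁

/-- **THE p. 89 BASE-CASE SENTENCE HOLDS IN CONTEXT — PROVED, for every `c₁ ≦ ¼`** (`η > 0`; all other data arbitrary).  In Theorem 4's setting at
`k = 1`, (1.66) at level `0` is «|U′ − 1| < α₁» on the bonds of `Ω₀` (`tavg_zero`); hence (a) «|U₁ − 1| < 4d²α₀ + α₁» on the bonds of
`Ω₁ ⊂ Ω₀` a fortiori (Lemma 1's printed output — in the (1.66)-form of the hypotheses the Lemma-1 iteration of p. 87 is already absorbed in `α₁`);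
(b) with `A = (1∕iη) log U₁` on the bonds of `Ω₀` (and `0` elsewhere, where nothing is asserted): `U₁ = e^{iηA}` there and `|A| ≦ 2|U₁ − 1|η⁻¹ <
2α₁η⁻¹` (`B8Thm4TruncationLocal.base_datum`, the logarithm estimate `|(1∕i) log U| ≦ 2|U − 1|` of [3] (26) for `|U − 1| ≦ ¼`), and for the
gradient `|∇^η_{U₀,κ}A_τ(x)| ≦ η⁻¹(|R(U₀(x, κ))A_τ(x + e_κ)| + |A_τ(x)|) < 4α₁η⁻²` (`R(U₀(b))` does not increase norms for unitary `U₀`,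
`B8Ineq132.norm_conjR` with `B7Prop2Explicit.unitaryUnits_le_U1`); finally `2α₁ ≦ 4α₁ ≦ 8d²(α₀ + α₁) ≦ 5dLB₀(α₀ + α₁) = B₁(α₀ + α₁)` by the clause `8d² ≦ 5dLB₀` (`d ≧ 1` as soon as
a bond exists) — print's «at least for B₁ not too small, e.g. for B₀ satisfying 5dLB₀ ≧ 8d²» with room to spare IN CONTEXT (check-3's
boundary witness against the context-free `BaseCaseK1Printed` has plaquette angle `≫ α₀η²` and `α₁ = 0`, outside (1.33)∕(1.66)).
[cite: Balaban1985RegularSpaces, p.89 (sentence after (1.74)), (1.69) p.88, (1.66) p.87, Lemma 1 (1.25) p.79; Balaban1985Averaging, (26) p.22] -/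
theorem baseCaseK1InContext_holds {L : ℕ} {η B₀ c₁ α₀ α₁ : ℝ} (hη : 0 < η) (hc₁ : c₁ ≤ 1 / 4)
    (Ω Λ : ℕ → Set (Site d)) (𝒬 : Set (Set (Site d) × ℕ)) (C : ℝ) (U₀ U₁ : Site d → Fin d → 𝔸ˣ) :
    BaseCaseK1InContextPrinted L η B₀ c₁ α₀ α₁ Ω Λ 𝒬 C U₀ U₁ := by
  classical
  intro hB hα₀ hα₁ hc hS
  obtain ⟨hU₀, hU₁, h10, -, -, h66, -⟩ := hS
  -- (1.66) at level 0: `‖U₁(b) − 1‖ < α₁` at every bond `b` of `Ω₀` (`Ũ′⁰ = U′ = U₁`)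
  have hsm : ∀ (x : Site d) (τ : Fin d), BondTouches (Ω 0) x τ → ‖((U₁ x τ : 𝔸ˣ) : 𝔸) - 1‖ < α₁ := by
    intro x τ hb
    have h := h66 x τ hb
    rwa [tavg_zero] at h
  have hα₁4 : α₁ ≤ 1 / 4 := by linarith
  have hη' : 0 < η⁻¹ := inv_pos.mpr hη
  refine ⟨fun x τ hb => (hsm x τ (hb.imp (fun h => h10 h) (fun h => h10 h))).trans_le (le_add_of_nonneg_left (by positivity)), ?_⟩
  -- the bondwise logarithm `A = (1/iη) log U₁` on the bonds of `Ω₀` (and `0` elsewhere, where nothing is asserted)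
  set A : Site d → Fin d → 𝔸 := fun y μ =>
    if BondTouches (Ω 0) y μ then η⁻¹ • ((I⁻¹ : ℂ) • mlog ((U₁ y μ : 𝔸ˣ) : 𝔸)) else 0 with hA
  have hbd : ∀ (x : Site d) (κ : Fin d), BondTouches (Ω 0) x κ →
      U₁ x κ = cfgExp η A x κ ∧ ‖A x κ‖ < 2 * α₁ * η⁻¹ := by
    intro x κ hb
    have hAx : A x κ = η⁻¹ • ((I⁻¹ : ℂ) • mlog ((U₁ x κ : 𝔸ˣ) : 𝔸)) := by rw [hA]; exact if_pos hb
    have ha : ‖((U₁ x κ : 𝔸ˣ) : 𝔸) - 1‖ ≤ 1 / 4 := (hsm x κ hb).le.trans hα₁4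
    obtain ⟨-, h2, -, h4⟩ := B8Thm4TruncationLocal.base_datum hη U₀ U₁ hU₁ ha x κ le_rfl
    refine ⟨?_, ?_⟩
    · rw [h2]
      apply Units.ext
      simp only [cfgExp, hAx]
    · rw [hAx]
      refine lt_of_le_of_lt h4 ?_
      have := hsm x κ hb
      nlinarith
  have hnorm : ∀ (y : Site d) (μ : Fin d), ‖A y μ‖ < 2 * α₁ * η⁻¹ := by
    intro y μ
    by_cases hb : BondTouches (Ω 0) y μ
    · exact (hbd y μ hb).2
    · have hAy : A y μ = 0 := by rw [hA]; exact if_neg hb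
      rw [hAy, norm_zero]
      positivity
  have hd_of : ∀ τ : Fin d, (1 : ℝ) ≤ d := fun τ => by
    have : 1 ≤ d := Nat.one_le_iff_ne_zero.mpr (fun h => by subst h; exact Fin.elim0 τ)
    exact_mod_cast this
  -- the constant: `4α₁ ≤ 8d²(α₀ + α₁) ≤ 5dLB₀(α₀ + α₁)` under the clause `8d² ≤ 5dLB₀`
  have hc4 : ∀ τ : Fin d, 4 * α₁ ≤ 5 * (d : ℝ) * L * B₀ * (α₀ + α₁) := by
    intro τ
    have hd := hd_of τ
    have hd2 : (1 : ℝ) ≤ (d : ℝ) ^ 2 := by nlinarith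
    have h0 : 8 * (α₀ + α₁) ≤ 8 * (d : ℝ) ^ 2 * (α₀ + α₁) := by
      have := mul_le_mul_of_nonneg_right hd2 (add_pos hα₀ hα₁).le
      linarith
    have h1 : 4 * α₁ ≤ 8 * (d : ℝ) ^ 2 * (α₀ + α₁) := by linarith
    exact h1.trans (mul_le_mul_of_nonneg_right hB (by linarith))
  refine ⟨A, fun x τ hb => (hbd x τ hb).1, ?_⟩
  intro j hj x τ hb
  have hj0 : j = 0 := by omega
  subst hj0
  simp only [pow_zero, one_mul]
  refine ⟨?_, fun κ => ?_⟩
  · calc ‖A x τ‖ < 2 * α₁ * η⁻¹ := hnorm x τ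
      _ ≤ 5 * (d : ℝ) * L * B₀ * (α₀ + α₁) * η⁻¹ := by
          refine mul_le_mul_of_nonneg_right ?_ hη'.le
          linarith [hc4 τ]
  · -- `‖∇^η_{U₀,κ}A_τ(x)‖ ≤ η⁻¹(‖R(U₀(x,κ))A(x + e_κ, τ)‖ + ‖A(x, τ)‖) < 4α₁η⁻²`
    have hconj : ‖conjR (U₀ x κ) (A (x + e κ) τ)‖ ≤ ‖A (x + e κ) τ‖ := by
      -- `R(U₀(b))` does not increase norms for unitary `U₀(b)` (an isometry when `𝔸` is non-trivial, [3] p. 24 «unitarily equivalent»)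
      rcases subsingleton_or_nontrivial 𝔸 with h | h
      · rw [Subsingleton.elim (conjR (U₀ x κ) (A (x + e κ) τ)) (A (x + e κ) τ)]
      · exact (B8Ineq132.norm_conjR (unitaryUnits_le_U1 (hU₀ x κ)) _).le
    have hcd : ‖covDerivFwd η U₀ κ (fun z => A z τ) x‖ ≤ η⁻¹ * (‖A (x + e κ) τ‖ + ‖A x τ‖) := by
      unfold covDerivFwd
      rw [norm_smul, Real.norm_eq_abs, abs_of_pos hη']
      refine mul_le_mul_of_nonneg_left ?_ hη'.le
      calc ‖conjR (U₀ x κ) (A (x + e κ) τ) - A x τ‖ ≤ ‖conjR (U₀ x κ) (A (x + e κ) τ)‖ + ‖A x τ‖ := norm_sub_le _ _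
        _ ≤ ‖A (x + e κ) τ‖ + ‖A x τ‖ := by linarith
    have h1 := hnorm (x + e κ) τ
    have h2 := hnorm x τ
    calc ‖covDerivFwd η U₀ κ (fun z => A z τ) x‖ ≤ η⁻¹ * (‖A (x + e κ) τ‖ + ‖A x τ‖) := hcd
      _ < η⁻¹ * (2 * α₁ * η⁻¹ + 2 * α₁ * η⁻¹) := by
          refine mul_lt_mul_of_pos_left ?_ hη'
          linarith
      _ = 4 * α₁ * (η⁻¹) ^ 2 := by ring
      _ ≤ 5 * (d : ℝ) * L * B₀ * (α₀ + α₁) * (η⁻¹) ^ 2 :=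
          mul_le_mul_of_nonneg_right (hc4 τ) (by positivity)

end InContext

end Literature.MathematicalPhysics.QuantumFieldTheory.Balaban1983to89.B8Carve03Prop5Hyp
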